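import Mathlib.NumberTheory.LSeries.PrimesInAP
import Literature.AlgebraicGeometry.Motives.FermatHypersurface
import Literature.AlgebraicGeometry.HodgeTheory.FermatHodgeCharacters
import HarnessLib

/-!
# Anchor primes for the Fermat half (B2) of `AnchorsAtGenericHodgeLocusPoints` (stmt-HodgeConjecture-13944)

Route `PadicSemiregularLift` of `HodgeConjecture`, informal support item
`AnchorsAtGenericHodgeLocusPoints` (P2b). Its Fermat half (B2) reads: for the Fermat hypersurface
`Y = Xⁿₘ ⊂ ℙⁿ⁺¹_ℂ`, `m ≥ 3`, every Hodge class `β` on `Y` and EVERY prime `p ≡ -1 (mod m)` with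
`p > n + 6`, the Fermat scheme `Xⁿₘ` over `W(𝔽̄_p)` is a `p`-adic anchor (special fibre
Shioda–Katsura supersingular with all classes algebraic; smooth hypersurface, so torsion-free Hodge
cohomology) at which `β_dR` is `φ`-Tate on the nose (Ogus 1982, Thm. 4.14). The item is informal
(no Lean signature yet); this helper file proves, over the carriers the tree already has, the
ARITHMETIC side conditions of (B2) that any typing will consume:

* `exists_prime_gt_and_eq_neg_one` / `setOf_prime_and_eq_neg_one_infinite`: for every degree
  `m ≥ 1` and every dimension `n` there are (infinitely many) primes `p > n + 6` with
  `p ≡ -1 (mod m)` — the anchor primes of (B2) EXIST (Dirichlet's theorem, Mathlib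
  `Nat.forall_exists_prime_gt_and_eq_mod`, for the unit `-1 ∈ (ℤ/m)ˣ`); in particular no
  supersingular prime of a FIXED variety is needed, exactly as the route text says;
* `dvd_add_one_of_eq_neg_one`, `not_dvd_of_eq_neg_one`, `dvd_sq_sub_one_of_eq_neg_one`: such a
  prime satisfies `m ∣ p + 1` (Shioda–Katsura's condition `p^ν ≡ -1 (mod m)` with `ν = 1`),
  `p ∤ m` (Shioda's standing hypothesis for `Xⁿₘ(p)`), and `m ∣ p² - 1` (all `m`-th roots of unity
  lie in `𝔽_{p²}`);
* `natCast_ne_zero_of_eq_neg_one`: hence `m ≠ 0` in every field of characteristic `p`;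
* `isSmoothProjective_fermat_specialFibre`: hence the special fibre of the Fermat anchor — the
  standard model `V₊(Σ xᵢᵐ) ⊂ ℙⁿ⁺¹` over `𝔽̄_p = AlgebraicClosure (ZMod p)` — is a smooth projective
  `n`-fold and a Fermat variety
  (`Motives.SmoothHypersurface.isSmoothProjective_hypersurface_fermatPolynomial`,
  `isFermatVariety_hypersurface_fermatPolynomial`), for `n ≥ 1`, `m ≥ 1`;
* `exists_fermat_anchor_prime`: the packaged existence statement;
* `two_mul_sum_normSum_eq_of_neg_mem`, `normSum_unit_add_normSum_neg_unit`: the COMBINATORIAL half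
  of Shioda–Katsura's supersingularity criterion in the tree's Fermat-character vocabulary
  (`HodgeTheory.FermatCharacter.normSum`): over any finite set of units stable under `t ↦ -t` — every
  coset of a subgroup `H ∋ -1` of `(ℤ/m)ˣ`, in particular of `H = ⟨p⟩ = {±1}` at an anchor prime —
  the norms `|tα|` of EVERY character with non-zero components average to `(n + 2)/2`, i.e. Shioda's
  condition `𝔅ⁿₘ(H) = 𝔄ⁿₘ` (Proc. Japan Acad. 55A §1) holds with no Hodge hypothesis.

What is NOT here (no carriers yet, or not this item's to state): the passage from Shioda's condition
to supersingularity / "all classes algebraic" of `Xⁿₘ ⊗ 𝔽̄_p` (Stickelberger's theorem on Jacobi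
sums; Shioda–Katsura 1979 §3; Tate 1965), the `W(𝔽̄_p)`-model and its generic fibre, and the
`φ`-Tate property of `β_dR` (Ogus 1982, Thm. 4.14; Blasius 1994).

References: T. Shioda, T. Katsura, *On Fermat varieties*, Tôhoku Math. J. 31 (1979) §3; T. Shioda,
*The Hodge conjecture and the Tate conjecture for Fermat varieties*, Proc. Japan Acad. 55A (1979)
§1; A. Ogus, *Hodge cycles and crystalline cohomology*, LNM 900 (1982), Thm. 4.14; Mathlib
`Mathlib/NumberTheory/LSeries/PrimesInAP.lean` (Dirichlet).
-/

-- the summit-side namespace `Summit.HodgeConjecture.HodgeConjecture.…` (summit = sub-problem, D-0017)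
-- repeats a component by design; the linter would flag every declaration.
set_option linter.dupNamespace false

noncomputable section

open Literature.AlgebraicGeometry.Motives

namespace Summit.HodgeConjecture.HodgeConjecture.Theorems.AnchorsAtGenericHodgeLocusPoints

/-! ### Existence of the anchor primes `p ≡ -1 (mod m)`, `p > n + 6` -/

/-- **Anchor primes for (B2) exist**: for every degree `m ≥ 1` (`NeZero m`) and every `n` there is
a prime `p > n + 6` with `p ≡ -1 (mod m)` (Dirichlet's theorem on primes in arithmetic
progressions for the unit `-1` of `ℤ/m`; Mathlib `Nat.forall_exists_prime_gt_and_eq_mod`). -/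
theorem exists_prime_gt_and_eq_neg_one (m n : ℕ) [NeZero m] :
    ∃ p > n + 6, p.Prime ∧ (p : ZMod m) = -1 :=
  Nat.forall_exists_prime_gt_and_eq_mod isUnit_one.neg (n + 6)

/-- The set of primes `p ≡ -1 (mod m)` is infinite (`m ≥ 1`), so (B2) has anchor primes beyond every
bound `n + 6` (Dirichlet; Mathlib `Nat.infinite_setOf_prime_and_eq_mod`). -/
theorem setOf_prime_and_eq_neg_one_infinite (m : ℕ) [NeZero m] :
    {p : ℕ | p.Prime ∧ (p : ZMod m) = -1}.Infinite :=
  Nat.infinite_setOf_prime_and_eq_mod isUnit_one.neg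

/-! ### Arithmetic consequences of `p ≡ -1 (mod m)` -/

/-- `p ≡ -1 (mod m)` means `m ∣ p + 1`: Shioda–Katsura's supersingularity condition
`p^ν ≡ -1 (mod m)` holds with `ν = 1`. -/
theorem dvd_add_one_of_eq_neg_one {m p : ℕ} (h : (p : ZMod m) = -1) : m ∣ p + 1 := by
  rw [← ZMod.natCast_eq_zero_iff, Nat.cast_add, Nat.cast_one, h, neg_add_cancel]

/-- A natural number `p ≠ 1` with `p ≡ -1 (mod m)` does not divide `m`: from `p ∣ m ∣ p + 1` one
gets `p ∣ 1`. For a prime `p` this is Shioda's standing hypothesis `p ∤ m` for `Xⁿₘ(p)`. -/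
theorem not_dvd_of_eq_neg_one {m p : ℕ} (h : (p : ZMod m) = -1) (hp : p ≠ 1) : ¬ p ∣ m :=
  fun hpm ↦ hp (Nat.dvd_one.1 ((Nat.dvd_add_right (dvd_refl p)).1
    (hpm.trans (dvd_add_one_of_eq_neg_one h))))

/-- `p ≡ -1 (mod m)` implies `m ∣ p² - 1 = (p + 1)(p - 1)`: the field `𝔽_{p²}` contains all
`m`-th roots of unity, so the `μₘⁿ⁺²`-action on `Xⁿₘ ⊗ 𝔽̄_p` and Shioda–Katsura's cycles are defined
over `𝔽_{p²}`. -/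
theorem dvd_sq_sub_one_of_eq_neg_one {m p : ℕ} (h : (p : ZMod m) = -1) : m ∣ p ^ 2 - 1 := by
  have hp : p ^ 2 - 1 = (p + 1) * (p - 1) := by
    rw [← Nat.sq_sub_sq, one_pow]
  rw [hp]
  exact (dvd_add_one_of_eq_neg_one h).mul_right _

/-- In a field of prime characteristic `p`, a degree `m` with `p ≡ -1 (mod m)` is nonzero:
`(m : k) ≠ 0`, because `p ∤ m`. -/
theorem natCast_ne_zero_of_eq_neg_one {m p : ℕ} (k : Type*) [Field k] [CharP k p] [Fact p.Prime]
    (h : (p : ZMod m) = -1) : (m : k) ≠ 0 := fun hmk ↦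
  not_dvd_of_eq_neg_one h (Fact.out : p.Prime).ne_one ((CharP.cast_eq_zero_iff k p m).1 hmk)

/-! ### The special fibre of the Fermat anchor is a smooth projective Fermat variety -/

/-- **The special fibre of the Fermat anchor is smooth projective.** For a prime `p ≡ -1 (mod m)`
(`m ≥ 1`, `n ≥ 1`) the standard model `V₊(x₀ᵐ + ⋯ + x_{n+1}ᵐ) ⊂ ℙⁿ⁺¹` over
`𝔽̄_p = AlgebraicClosure (ZMod p)` is a smooth projective geometrically integral `n`-fold
(`IsSmoothProjective n`) and a Fermat variety (`IsFermatVariety n m`): `m ≠ 0` in `𝔽̄_p` by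
`natCast_ne_zero_of_eq_neg_one`, then the tree's Jacobian/Eisenstein theorem
`SmoothHypersurface.isSmoothProjective_hypersurface_fermatPolynomial`. This is the "smooth
hypersurface" clause (ii) of the anchor in (B2), on the special fibre. -/
theorem isSmoothProjective_fermat_specialFibre {n m p : ℕ} [Fact p.Prime] (hn : 1 ≤ n) (hm : 1 ≤ m)
    (h : (p : ZMod m) = -1) :
    IsSmoothProjective n
        (SmoothHypersurface.hypersurface (fermatPolynomial (AlgebraicClosure (ZMod p)) n m)) ∧
      IsFermatVariety n m
        (SmoothHypersurface.hypersurface (fermatPolynomial (AlgebraicClosure (ZMod p)) n m)) :=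
  ⟨SmoothHypersurface.isSmoothProjective_hypersurface_fermatPolynomial hn hm
      (natCast_ne_zero_of_eq_neg_one (AlgebraicClosure (ZMod p)) h),
    SmoothHypersurface.isFermatVariety_hypersurface_fermatPolynomial _ n m⟩

/-- **(B2), arithmetic part, packaged.** For every dimension `n ≥ 1` and degree `m ≥ 1` there is a
prime `p` with `p > n + 6`, `p ≡ -1 (mod m)` (so `m ∣ p + 1`, `m ∣ p² - 1`, `p ∤ m`), at which the
special fibre `Xⁿₘ ⊗ 𝔽̄_p` of the Fermat anchor is a smooth projective Fermat `n`-fold. (The remaining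
clauses of the anchor — cohomological supersingularity of `Xⁿₘ ⊗ 𝔽̄_p`, Shioda–Katsura 1979 /
Tate 1965, and the `φ`-Tate property of Hodge classes, Ogus 1982 Thm. 4.14 — are theorems in print
without carriers in the tree yet.) -/
theorem exists_fermat_anchor_prime (n m : ℕ) (hn : 1 ≤ n) (hm : 1 ≤ m) :
    ∃ p : ℕ, ∃ _ : Fact p.Prime, n + 6 < p ∧ (p : ZMod m) = -1 ∧ m ∣ p + 1 ∧ m ∣ p ^ 2 - 1 ∧
      ¬ p ∣ m ∧
      IsSmoothProjective n
        (SmoothHypersurface.hypersurface (fermatPolynomial (AlgebraicClosure (ZMod p)) n m)) ∧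
      IsFermatVariety n m
        (SmoothHypersurface.hypersurface (fermatPolynomial (AlgebraicClosure (ZMod p)) n m)) := by
  haveI : NeZero m := ⟨by omega⟩
  obtain ⟨p, hpn, hp, h⟩ := exists_prime_gt_and_eq_neg_one m n
  haveI : Fact p.Prime := ⟨hp⟩
  exact ⟨p, ‹Fact p.Prime›, hpn, h, dvd_add_one_of_eq_neg_one h, dvd_sq_sub_one_of_eq_neg_one h,
    not_dvd_of_eq_neg_one h hp.ne_one, isSmoothProjective_fermat_specialFibre hn hm h⟩

/-! ### Shioda–Katsura's combinatorial supersingularity lemma: `-1 ∈ H` forces Shioda's condition for every character -/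

open Literature.AlgebraicGeometry.HodgeTheory Literature.AlgebraicGeometry.HodgeTheory.FermatCharacter
  Finset in
/-- **Shioda–Katsura's combinatorial lemma behind "`p^ν ≡ -1 (mod m)` ⇒ `Xⁿₘ ⊗ 𝔽̄_p` supersingular".**
Shioda (Proc. Japan Acad. 55A (1979) §1) attaches to a subgroup `H ≤ (ℤ/m)ˣ` the set `𝔅ⁿₘ(H)` of
characters `α ∈ 𝔄ⁿₘ` with `Σ_{t ∈ H'} |tα| = |H'| (n/2 + 1)` for every coset `H'` of `H`
(`H = {1}`: the Hodge characters `IsHodge`; `H = ⟨p mod m⟩`: the Tate characters of `Xⁿₘ ⊗ 𝔽_q`, by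
Stickelberger's theorem on the Jacobi sums, Weil / Shioda–Katsura 1979 §3), and `Xⁿₘ ⊗ 𝔽̄_p` is
supersingular iff `𝔅(⟨p⟩) = 𝔄` iff `-1 ∈ ⟨p mod m⟩`. The elementary half used by (B2) (`ν = 1`,
`p ≡ -1`): if a finite set `S` of units is stable under `t ↦ -t` (e.g. any coset of a subgroup
containing `-1`), then for EVERY character `α` with non-zero components (no Hodge condition),
`2 Σ_{t ∈ S} m|tα| = |S| · m · r` (`r = n + 2`), i.e. `Σ_{t ∈ S} |tα| = |S| (n/2 + 1)`: reindex the
sum by `t ↦ -t` and use `|β| + |-β| = r` (`normSum_add_normSum_neg`). In the tree's normalisation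
`normSum β = m |β|`. -/
theorem two_mul_sum_normSum_eq_of_neg_mem {m r : ℕ} [NeZero m] {S : Finset (ZMod m)ˣ}
    (hS : ∀ t ∈ S, -t ∈ S) {α : Fin r → ZMod m} (hα : ∀ i, α i ≠ 0) :
    2 * ∑ t ∈ S, normSum (fun i ↦ (t : ZMod m) * α i) = S.card * (m * r) := by
  -- reindex by the involution `t ↦ -t` of `S`
  have hre : ∑ t ∈ S, normSum (fun i ↦ (t : ZMod m) * α i) =
      ∑ t ∈ S, normSum (fun i ↦ ((-t : (ZMod m)ˣ) : ZMod m) * α i) := by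
    refine sum_equiv (Equiv.neg (ZMod m)ˣ) (fun t ↦ ⟨fun ht ↦ hS t ht, fun ht ↦ ?_⟩) (fun t _ ↦ ?_)
    · simpa using hS _ ht
    · simp
  have hne : ∀ (t : (ZMod m)ˣ) (i : Fin r), (t : ZMod m) * α i ≠ 0 := fun t i ↦
    (Units.mul_right_eq_zero t).not.mpr (hα i)
  calc 2 * ∑ t ∈ S, normSum (fun i ↦ (t : ZMod m) * α i)
      = ∑ t ∈ S, normSum (fun i ↦ (t : ZMod m) * α i) +
          ∑ t ∈ S, normSum (fun i ↦ ((-t : (ZMod m)ˣ) : ZMod m) * α i) := by rw [two_mul, ← hre]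
    _ = ∑ t ∈ S, (normSum (fun i ↦ (t : ZMod m) * α i) + normSum (-fun i ↦ (t : ZMod m) * α i)) := by
        rw [← sum_add_distrib]
        refine sum_congr rfl fun t _ ↦ ?_
        congr 2
        funext i
        simp [Units.val_neg, neg_mul]
    _ = ∑ t ∈ S, m * r := sum_congr rfl fun t _ ↦ normSum_add_normSum_neg (hne t)
    _ = S.card * (m * r) := by rw [sum_const, smul_eq_mul]

open Literature.AlgebraicGeometry.HodgeTheory Literature.AlgebraicGeometry.HodgeTheory.FermatCharacter
  Finset in
/-- **At an anchor prime `p ≡ -1 (mod m)` every character satisfies Shioda's condition for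
`H = ⟨p⟩ = {±1}`:** for every `α` with non-zero components and every unit `u` (coset `u·{±1}`),
`2 (m|uα| + m|-uα|) = 2 · m · r`, i.e. `|uα| + |(-u)α| = n + 2` — the case `S = {u, -u}` of
`two_mul_sum_normSum_eq_of_neg_mem`, stated without the factor `2` via `normSum_add_normSum_neg`.
Combined with Stickelberger's theorem (not in the tree) this is Shioda–Katsura's "`Xⁿₘ ⊗ 𝔽̄_p` is
supersingular for `p ≡ -1 (mod m)`", clause (i) of the Fermat anchor of (B2). -/
theorem normSum_unit_add_normSum_neg_unit {m r : ℕ} [NeZero m] {α : Fin r → ZMod m}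
    (hα : ∀ i, α i ≠ 0) (u : (ZMod m)ˣ) :
    normSum (fun i ↦ (u : ZMod m) * α i) + normSum (fun i ↦ ((-u : (ZMod m)ˣ) : ZMod m) * α i) =
      m * r := by
  have h : (fun i ↦ ((-u : (ZMod m)ˣ) : ZMod m) * α i) = -fun i ↦ (u : ZMod m) * α i := by
    funext i
    simp [Units.val_neg, neg_mul]
  rw [h]
  exact normSum_add_normSum_neg fun i ↦ (Units.mul_right_eq_zero u).not.mpr (hα i)

end Summit.HodgeConjecture.HodgeConjecture.Theorems.AnchorsAtGenericHodgeLocusPoints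

end
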